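import Mathlib
import Literature.Probability.Process.PositiveSupermartingaleConvergence
import Literature.Probability.Process.GaltonWatsonExtinction
import HarnessLib

/-!
# Durrett §4.3, Exercises: vanishing infinite products `∏ (1 − p_m)` (4.3.4), divergent successive
# conditional probabilities (4.3.5), and Galton–Watson's family-name problem (4.3.13)

[topic Probability/Process]

| Durrett 2019, §4.3, Exercises (pp. 211–212) | declaration | status |
|---|---|---|
| Theorem 4.3.4 (second Borel–Cantelli lemma, II — Lévy) | Mathlib's `MeasureTheory.ae_mem_limsup_atTop_iff` | not restated |
| 4.3.4: `p_m ∈ [0,1)`: `∏ (1 − p_m) = 0 ⟺ Σ p_m = ∞` | `Durrett2019_exercise_4_3_4` | proved |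
| 4.3.5: `Σ_n P(A_n | ∩_{m<n} A_m^c) = ∞ ⟹ P(∩_m A_m^c) = 0` | `Durrett2019_exercise_4_3_5`, `Durrett2019_exercise_4_3_5_tsum` | proved |
| 4.3.13: three children, fair coin sexes (`p_0, p_1, p_2, p_3 = 1/8, 3/8, 3/8, 1/8`) ⟹ extinction probability `ρ = √5 − 2` | `Durrett2019_exercise_4_3_13` | proved |

Not treated here: 4.3.1–4.3.3, 4.3.6–4.3.7, 4.3.11–4.3.12 (4.3.8–4.3.10 are the tree's
`KakutaniBernoulliProductMeasures`).

Proofs.  4.3.4: `0 ≤ ∏_{m<n} (1 − p_m) ≤ exp(−Σ_{m<n} p_m) → 0` when the series diverges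
(`1 − p ≤ e^{−p}`); conversely for `Σ p_m < ∞` Exercise 4.2.7 (the tree's
`Durrett2019_exercise_4_2_7`, with `y_m = −p_m > −1`) gives a strictly positive limit.  (Durrett
suggests the Borel–Cantelli lemmas for independent events of probabilities `p_m`; the analytic
road is shorter in the tree.)  4.3.5: with `B_n = ∩_{m<n} A_m^c` and `q_n = P(A_n | B_n)`,
`P(B_{n+1}) = P(B_n)(1 − q_n)` (also when `P(B_n) = 0`, Mathlib's `P(· | B_n)` being `0` then), so
`P(B_n) = P(Ω) ∏_{m<n} (1 − q_m) → 0` by the first half of 4.3.4 (which only needs `q_m ∈ [0,1]`),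
and `∩_m A_m^c ⊆ B_n`.  4.3.13: the offspring generating function is
`φ(x) = (1 + 3x + 3x² + x³)/8`; `φ(x) = x` factors as `(x − 1)(x² + 4x − 1) = 0`, whose roots in
`[0, 1]` are `√5 − 2 < 1`; so `√5 − 2` is the least root of `φ` in `[0,1]`, which is the extinction
probability by Theorem 4.3.12 (the tree's `Durrett2019_thm_4_3_12_isLeast`).

## References
* [Durrett2019] R. Durrett, *Probability: Theory and Examples*, 5th ed., Cambridge Series in
  Statistical and Probabilistic Mathematics 49, Cambridge University Press (2019): §4.3
  (Examples), Theorem 4.3.4, p. 205; Exercises 4.3.4, 4.3.5, p. 211; Exercise 4.3.13, p. 212;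
  Theorem 4.3.12, p. 210.
-/

namespace Literature.Probability.Process

open _root_.MeasureTheory _root_.ProbabilityTheory Filter
open scoped ENNReal NNReal Topology

variable {Ω : Type*} {m₀ : MeasurableSpace Ω} {μ : Measure Ω}

/-! ## Exercise 4.3.4: `∏ (1 − p_m) = 0 ⟺ Σ p_m = ∞` -/

/-- If `0 ≤ p_m ≤ 1` and `Σ p_m = ∞` then `∏_{m<n} (1 − p_m) → 0`
(`0 ≤ ∏_{m<n} (1 − p_m) ≤ exp(−Σ_{m<n} p_m)`). [cite: Durrett2019, §4.3 Exercise 4.3.4, p. 211 (proof step)] -/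
theorem tendsto_prod_one_sub_of_not_summable {p : ℕ → ℝ} (h0 : ∀ n, 0 ≤ p n) (h1 : ∀ n, p n ≤ 1)
    (hs : ¬ Summable p) :
    Tendsto (fun n => ∏ m ∈ Finset.range n, (1 - p m)) atTop (𝓝 0) := by
  have hup : ∀ n, ∏ m ∈ Finset.range n, (1 - p m) ≤ Real.exp (-∑ m ∈ Finset.range n, p m) := by
    intro n
    rw [← Finset.sum_neg_distrib, Real.exp_sum]
    exact Finset.prod_le_prod (fun m _ => sub_nonneg.2 (h1 m))
      fun m _ => by linarith [Real.add_one_le_exp (-p m)]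
  have hlow : ∀ n, 0 ≤ ∏ m ∈ Finset.range n, (1 - p m) :=
    fun n => Finset.prod_nonneg fun m _ => sub_nonneg.2 (h1 m)
  have hdiv : Tendsto (fun n => ∑ m ∈ Finset.range n, p m) atTop atTop :=
    (not_summable_iff_tendsto_nat_atTop_of_nonneg h0).1 hs
  have hexp : Tendsto (fun n => Real.exp (-∑ m ∈ Finset.range n, p m)) atTop (𝓝 0) :=
    Real.tendsto_exp_atBot.comp (tendsto_neg_atTop_atBot.comp hdiv)
  exact tendsto_of_tendsto_of_tendsto_of_le_of_le tendsto_const_nhds hexp hlow hup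

/-- **Durrett, Exercise 4.3.4.** Let `p_m ∈ [0, 1)`.  Then `∏_{m=1}^∞ (1 − p_m) = 0` if and only if
`Σ_{m=1}^∞ p_m = ∞`; here: the partial products tend to `0` iff `(p_m)` is not summable.
[cite: Durrett2019, §4.3 Exercise 4.3.4, p. 211] -/
theorem Durrett2019_exercise_4_3_4 {p : ℕ → ℝ} (h0 : ∀ n, 0 ≤ p n) (h1 : ∀ n, p n < 1) :
    Tendsto (fun n => ∏ m ∈ Finset.range n, (1 - p m)) atTop (𝓝 0) ↔ ¬ Summable p := by
  constructor
  · intro ht hs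
    have habs : ∀ n, |p n| = p n := fun n => abs_of_nonneg (h0 n)
    obtain ⟨L, hL, hP⟩ := Durrett2019_exercise_4_2_7 (y := fun n => -p n)
      (fun n => by linarith [h1 n]) (by simpa only [abs_neg, habs] using hs)
    have e : (fun n => ∏ m ∈ Finset.range n, (1 + -p m)) =
        fun n => ∏ m ∈ Finset.range n, (1 - p m) := by
      simp only [← sub_eq_add_neg]
    rw [e] at hP
    exact hL.ne (tendsto_nhds_unique ht hP)
  · exact tendsto_prod_one_sub_of_not_summable h0 fun n => (h1 n).le

/-! ## Exercise 4.3.5: divergent successive conditional probabilities -/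

/-- **Durrett, Exercise 4.3.5.** `Σ_n P(A_n | ∩_{m<n} A_m^c) = ∞` implies `P(∩_m A_m^c) = 0`.  Here
`P(· | B)` is Mathlib's `μ[|B]` (which is `0` when `P(B) = 0`), and "`= ∞`" is "not summable".
[cite: Durrett2019, §4.3 Exercise 4.3.5, p. 211] -/
theorem Durrett2019_exercise_4_3_5 [IsFiniteMeasure μ] {A : ℕ → Set Ω} (hA : ∀ n, MeasurableSet (A n))
    (h : ¬ Summable fun n => (μ[|⋂ m ∈ Finset.range n, (A m)ᶜ]).real (A n)) :
    μ (⋂ n, (A n)ᶜ) = 0 := by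
  set B : ℕ → Set Ω := fun n => ⋂ m ∈ Finset.range n, (A m)ᶜ with hB
  have hBm : ∀ n, MeasurableSet (B n) := fun n =>
    Finset.measurableSet_biInter _ fun m _ => (hA m).compl
  have hBsucc : ∀ n, B (n + 1) = B n ∩ (A n)ᶜ := fun n => by
    show (⋂ m ∈ Finset.range (n + 1), (A m)ᶜ) = (⋂ m ∈ Finset.range n, (A m)ᶜ) ∩ (A n)ᶜ
    rw [Finset.range_add_one, Finset.set_biInter_insert, Set.inter_comm]
  -- `q n = P(A_n | B_n) = P(B_n ∩ A_n)/P(B_n)` (`= 0` if `P(B_n) = 0`), `q n ∈ [0, 1]`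
  have hq : ∀ n, (μ[|B n]).real (A n) = (μ.real (B n))⁻¹ * μ.real (B n ∩ A n) := fun n => by
    simp only [measureReal_def, cond_apply (hBm n) μ (A n), ENNReal.toReal_mul, ENNReal.toReal_inv]
  have hq0 : ∀ n, 0 ≤ (μ[|B n]).real (A n) := fun n => measureReal_nonneg
  have hq1 : ∀ n, (μ[|B n]).real (A n) ≤ 1 := fun n => by
    rw [hq, inv_mul_eq_div]
    exact div_le_one_of_le₀ (measureReal_mono Set.inter_subset_left) measureReal_nonneg
  -- `P(B_{n+1}) = P(B_n) (1 − q_n)`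
  have hrec : ∀ n, μ.real (B (n + 1)) = μ.real (B n) * (1 - (μ[|B n]).real (A n)) := by
    intro n
    have hsplit : μ.real (B n ∩ (A n)ᶜ) = μ.real (B n) - μ.real (B n ∩ A n) := by
      have h2 := measureReal_inter_add_sdiff (μ := μ) (s := B n) (hA n)
      rw [Set.sdiff_eq_compl_inter, Set.inter_comm (A n)ᶜ (B n)] at h2
      linarith
    rw [hBsucc, hsplit, hq]
    by_cases h0 : μ.real (B n) = 0
    · have h3 : μ.real (B n ∩ A n) = 0 :=
        le_antisymm ((measureReal_mono Set.inter_subset_left).trans h0.le) measureReal_nonneg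
      rw [h0, h3]
      ring
    · field_simp
  have hprod : ∀ n, μ.real (B n) =
      μ.real Set.univ * ∏ m ∈ Finset.range n, (1 - (μ[|B m]).real (A m)) := by
    intro n
    induction n with
    | zero =>
      have : B 0 = Set.univ := by
        show (⋂ m ∈ Finset.range 0, (A m)ᶜ) = Set.univ
        simp
      rw [this, Finset.prod_range_zero, mul_one]
    | succ k ih => rw [hrec, ih, Finset.prod_range_succ, mul_assoc]
  have ht : Tendsto (fun n => μ.real (B n)) atTop (𝓝 0) := by
    have h2 := (tendsto_prod_one_sub_of_not_summable hq0 hq1 h).const_mul (μ.real Set.univ)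
    rw [mul_zero] at h2
    refine h2.congr fun n => ?_
    exact (hprod n).symm
  have hle : ∀ n, μ.real (⋂ k, (A k)ᶜ) ≤ μ.real (B n) := fun n =>
    measureReal_mono (Set.subset_iInter₂ fun m _ => Set.iInter_subset (fun k => (A k)ᶜ) m)
  have h0 : μ.real (⋂ k, (A k)ᶜ) = 0 := le_antisymm (ge_of_tendsto' ht hle) measureReal_nonneg
  exact (measureReal_eq_zero_iff (measure_ne_top μ _)).1 h0

/-- **Durrett, Exercise 4.3.5**, with the hypothesis written as `Σ_n P(A_n | ∩_{m<n} A_m^c) = ∞`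
in `[0, ∞]`. [cite: Durrett2019, §4.3 Exercise 4.3.5, p. 211] -/
theorem Durrett2019_exercise_4_3_5_tsum [IsFiniteMeasure μ] {A : ℕ → Set Ω}
    (hA : ∀ n, MeasurableSet (A n))
    (h : ∑' n, μ[|⋂ m ∈ Finset.range n, (A m)ᶜ] (A n) = ∞) : μ (⋂ n, (A n)ᶜ) = 0 := by
  refine Durrett2019_exercise_4_3_5 hA fun hs => ?_
  have e : ∀ n, μ[|⋂ m ∈ Finset.range n, (A m)ᶜ] (A n) =
      ENNReal.ofReal ((μ[|⋂ m ∈ Finset.range n, (A m)ᶜ]).real (A n)) := fun n => by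
    rw [measureReal_def, ENNReal.ofReal_toReal (measure_ne_top _ _)]
  have h2 : ∑' n, μ[|⋂ m ∈ Finset.range n, (A m)ᶜ] (A n) =
      ENNReal.ofReal (∑' n, (μ[|⋂ m ∈ Finset.range n, (A m)ᶜ]).real (A n)) := by
    rw [ENNReal.ofReal_tsum_of_nonneg (fun n => measureReal_nonneg) hs]
    exact tsum_congr e
  rw [h2] at h
  exact ENNReal.ofReal_ne_top h

/-! ## Exercise 4.3.13: survival of family names -/

/-- Integration against a four-atom measure `a δ_x + b δ_y + c δ_z + d δ_w` (finite weights,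
measurable singletons): no hypothesis on the integrand.
[cite: Durrett2019, §4.3 Exercise 4.3.13, p. 212 (proof step: the offspring law)] -/
theorem integral_four_diracs {α E : Type*} [MeasurableSpace α] [MeasurableSingletonClass α]
    [NormedAddCommGroup E] [NormedSpace ℝ E] [CompleteSpace E] (f : α → E) {a b c d : ℝ≥0∞}
    (ha : a ≠ ∞) (hb : b ≠ ∞) (hc : c ≠ ∞) (hd : d ≠ ∞) (x y z w : α) :
    ∫ u, f u ∂(a • Measure.dirac x + b • Measure.dirac y + c • Measure.dirac z +
        d • Measure.dirac w) =
      a.toReal • f x + b.toReal • f y + c.toReal • f z + d.toReal • f w := by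
  have hint : ∀ (v : α) (e : ℝ≥0∞), e ≠ ∞ → Integrable f (e • Measure.dirac v) := fun v e he =>
    ((integrable_const (f v)).congr (ae_eq_dirac f).symm).smul_measure he
  rw [integral_add_measure (((hint x a ha).add_measure (hint y b hb)).add_measure (hint z c hc))
      (hint w d hd),
    integral_add_measure ((hint x a ha).add_measure (hint y b hb)) (hint z c hc),
    integral_add_measure (hint x a ha) (hint y b hb)]
  simp only [integral_smul_measure, integral_dirac]

/-- **Durrett, Exercise 4.3.13 (Galton and Watson's family names).** Each family has exactly three
children whose sexes are decided by fair coin flips and only sons carry the name, so the number of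
sons is a branching process with offspring law `p_0 = 1/8, p_1 = 3/8, p_2 = 3/8, p_3 = 1/8`.  The
probability that the family name dies out when `Z_0 = 1` is `ρ = √5 − 2 ≈ 0.236`, the root in
`[0, 1)` of `φ(ρ) = (1 + 3ρ + 3ρ² + ρ³)/8 = ρ`, i.e. of `ρ² + 4ρ − 1 = 0`.  (Setting of the tree's
`GaltonWatsonExtinction`: i.i.d. offspring array `ξ`, `Z_0 = 1`, `Z_{n+1} = ξⁿ_1 + ⋯ + ξⁿ_{Z_n}`.)
[cite: Durrett2019, §4.3 Exercise 4.3.13, p. 212] -/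
theorem Durrett2019_exercise_4_3_13 [IsProbabilityMeasure μ] {ξ : ℕ → ℕ → Ω → ℕ} {Z : ℕ → Ω → ℕ}
    (hξ : ∀ n i, Measurable (ξ n i)) (hind : iIndepFun (fun p : ℕ × ℕ => ξ p.1 p.2) μ)
    (hid : ∀ n i, IdentDistrib (ξ n i) (ξ 0 0) μ μ)
    (hZ0 : ∀ ω, Z 0 ω = 1) (hZ : ∀ n ω, Z (n + 1) ω = ∑ i ∈ Finset.range (Z n ω), ξ n i ω)
    (hlaw : μ.map (ξ 0 0) = ENNReal.ofReal (1 / 8) • Measure.dirac 0 +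
        ENNReal.ofReal (3 / 8) • Measure.dirac 1 + ENNReal.ofReal (3 / 8) • Measure.dirac 2 +
        ENNReal.ofReal (1 / 8) • Measure.dirac 3) :
    μ {ω | ∃ n, Z n ω = 0} = ENNReal.ofReal (Real.sqrt 5 - 2) := by
  -- the generating function `φ(x) = E x^ξ = (1 + 3x + 3x² + x³)/8`
  have hφ : ∀ x : ℝ, ∫ ω, x ^ (ξ 0 0 ω) ∂μ = (1 + 3 * x + 3 * x ^ 2 + x ^ 3) / 8 := by
    intro x
    have h1 : ∫ ω, x ^ (ξ 0 0 ω) ∂μ = ∫ k, x ^ k ∂(μ.map (ξ 0 0)) := by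
      rw [integral_map (hξ 0 0).aemeasurable]
      exact (measurable_of_countable fun k : ℕ => x ^ k).aestronglyMeasurable
    rw [h1, hlaw, integral_four_diracs _ ENNReal.ofReal_ne_top ENNReal.ofReal_ne_top
      ENNReal.ofReal_ne_top ENNReal.ofReal_ne_top,
      ENNReal.toReal_ofReal (by norm_num : (0 : ℝ) ≤ 1 / 8),
      ENNReal.toReal_ofReal (by norm_num : (0 : ℝ) ≤ 3 / 8)]
    simp only [smul_eq_mul, pow_zero, pow_one]
    ring
  have hs5 : Real.sqrt 5 ^ 2 = 5 := Real.sq_sqrt (by norm_num)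
  have hs_gt : 2 < Real.sqrt 5 := (Real.lt_sqrt (by norm_num)).2 (by norm_num)
  have hs_lt : Real.sqrt 5 < 3 := (Real.sqrt_lt' (by norm_num)).2 (by norm_num)
  have hfix : ∫ ω, (Real.sqrt 5 - 2) ^ (ξ 0 0 ω) ∂μ = Real.sqrt 5 - 2 := by
    rw [hφ]
    linear_combination ((Real.sqrt 5 - 3) / 8) * hs5
  have hleast : IsLeast {x : ℝ | x ∈ Set.Icc (0 : ℝ) 1 ∧ ∫ ω, x ^ (ξ 0 0 ω) ∂μ = x}
      (Real.sqrt 5 - 2) := by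
    refine ⟨⟨⟨by linarith, by linarith⟩, hfix⟩, ?_⟩
    rintro x ⟨⟨hx0, hx1⟩, hx⟩
    rw [hφ] at hx
    have hfac : (x - 1) * (x ^ 2 + 4 * x - 1) = 0 := by linear_combination 8 * hx
    rcases mul_eq_zero.1 hfac with h1 | h2
    · have hx' : x = 1 := by linarith
      rw [hx']
      linarith
    · have hx2 : (x + 2) ^ 2 = 5 := by linear_combination h2
      have hx3 : x + 2 = Real.sqrt 5 := by
        rw [← Real.sqrt_sq (by linarith : (0 : ℝ) ≤ x + 2), hx2]
      linarith
  exact Durrett2019_thm_4_3_12_isLeast hξ hind hid hZ0 hZ hleast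

end Literature.Probability.Process
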